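import Mathlib
import HarnessLib

/-!
# Subharmonic and plurisubharmonic functions; Lelong numbers

Topic `Literature/Analysis/Pluripotential`, opened by the definition request
`defn-NonPluripolarMongeAmpereMass` (route `HodgeConjecture/HeightMassDefect`), items (1) and (3) of
that request: plurisubharmonic (psh) functions and Lelong numbers. Everything here is a REAL
definition; no named facts.

**Mathlib status (v4.32).** Mathlib has harmonic functions on inner-product spaces, circle averages
`Real.circleAverage` of normed-space-valued functions and Nevanlinna theory, but neither subharmonic
nor plurisubharmonic functions nor Lelong numbers (searched `ubharmonic`, `lurisubharmonic`,
`Lelong`, `luripolar`). The lattice notions `Literature.Probability.LatticeModels.IsZdSubharmonicOn`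
are unrelated discrete objects.

**Values in `[-∞, +∞)`.** A psh function takes the value `-∞` (e.g. `log |f|` on `{f = 0}`; every
point of positive Lelong number is a `-∞` pole), so functions are `EReal`-valued and required to be
`< ⊤`. The mean value over a circle of such a function is the Lebesgue integral of a function that
is bounded above on the circle (u.s.c.), with value in `[-∞, +∞)`; we render it as the difference
`∫ g⁺ - ∫ g⁻` of normalised lower Lebesgue integrals (`circleMean`), which is that integral whenever
`∫ g⁺ < ∞` and the junk value `⊥` (Mathlib: `⊤ - ⊤ = ⊥` in `EReal`) otherwise.

**Definitions (as printed).**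
* `IsSubharmonicOn u U` — Hörmander, Def. 1.6.1 in the equivalent mean-value form of Thm. 1.6.3
  (ii)/(iii) with Dirac masses `dμ = δ_R`: `u` is upper semicontinuous on the open set `U ⊆ ℂ`, with
  values in `[-∞, +∞)`, and `u(c) ≤ (2π)⁻¹ ∫₀^{2π} u(c + R e^{iθ}) dθ` for every closed disc
  `D̄(c, R) ⊆ U`. As in Hörmander, `u ≡ -∞` is allowed.
* `IsPlurisubharmonicOn u Ω` — Hörmander, Def. 2.6.1 (there `Ω ⊆ ℂⁿ`; verbatim for an open subset
  of any complex normed space `E`): `u` is upper semicontinuous on `Ω`, `< +∞`, and for all `z, w`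
  the function `τ ↦ u(z + τw)` is subharmonic where it is defined.
* `lelongNumber u a = sup {γ ≥ 0 | u(z) ≤ γ log ‖z - a‖ + O(1) near a}` (Kiselman–Demailly form of
  the Lelong number of a psh function at a point, independent of the norm and of holomorphic changes
  of coordinates; printed in this form in [DangDoPham2025, §2.1]). For `u` psh and `≢ -∞` near `a`
  this is a finite maximum and equals `lim_{r→0} (sup_{B(a,r)} u)/log r`; junk value `0`
  (`Real.sSup` of an unbounded set) when `u ≡ -∞` near `a` (classically `+∞`).

**What is NOT here.** Maximum principle, Hartogs/regularisation theorems, `dd^c u ≥ 0` as a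
current, Siu's analyticity of Lelong upper level sets, pluripolar sets as a theory (only the
predicate `IsCompletePluripolarIn`), Bedford–Taylor products (see
`NonPluripolarMongeAmpereMass.lean` of this directory for the projective-space package).

## References
* [HormanderSCV1973] L. Hörmander, An introduction to complex analysis in several variables,
  2nd ed. (1973): §1.6 Def. 1.6.1, Thms. 1.6.2, 1.6.3, Cor. 1.6.6; §2.6 Def. 2.6.1, Thm. 2.6.4.
* [DangDoPham2025] Q.-T. Dang, H.-S. Do, H. H. Pham, Singularities vs non-pluripolar
  Monge–Ampère masses, Math. Z. (2025), arXiv:2503.07534: §2.1 (Lelong number).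
* [BoucksomEtAl2010] Boucksom–Eyssidieux–Guedj–Zeriahi, Acta Math. 205 (2010): Def. 1.2
  (complete pluripolar sets, small unbounded locus).
-/

noncomputable section

open scoped Topology ENNReal
open MeasureTheory Filter Set Metric

namespace Literature.Analysis.Pluripotential

/-! ### Mean values over circles of `[-∞, +∞]`-valued functions -/

/-- The normalised lower Lebesgue integral `(2π)⁻¹ ∫₀^{2π} g(c + R e^{iθ})⁺ dθ ∈ [0, ∞]` of the
POSITIVE PART of `g : ℂ → EReal` over the circle of centre `c` and radius `R`
(`circleMap c R θ = c + R e^{iθ}`; `EReal.toENNReal` sends `[-∞, 0]` to `0`). [folklore] -/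
def circleUpperMean (g : ℂ → EReal) (c : ℂ) (R : ℝ) : ℝ≥0∞ :=
  (∫⁻ θ in Ioc (0 : ℝ) (2 * Real.pi), (g (circleMap c R θ)).toENNReal) / ENNReal.ofReal (2 * Real.pi)

/-- The normalised lower Lebesgue integral `(2π)⁻¹ ∫₀^{2π} g(c + R e^{iθ})⁻ dθ ∈ [0, ∞]` of the
NEGATIVE PART of `g : ℂ → EReal` over the circle of centre `c` and radius `R`. [folklore] -/
def circleLowerMean (g : ℂ → EReal) (c : ℂ) (R : ℝ) : ℝ≥0∞ :=
  (∫⁻ θ in Ioc (0 : ℝ) (2 * Real.pi), (-g (circleMap c R θ)).toENNReal) / ENNReal.ofReal (2 * Real.pi)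

/-- The **mean value** `(2π)⁻¹ ∫₀^{2π} g(c + R e^{iθ}) dθ ∈ [-∞, +∞]` of `g : ℂ → EReal` over the
circle of centre `c` and radius `R`, defined as `∫ g⁺ - ∫ g⁻` (normalised lower Lebesgue integrals).
For `g` bounded above on the circle (e.g. upper semicontinuous and `< ⊤`) the positive part is
finite and this is the Lebesgue integral of `g`, with value in `[-∞, +∞)` ("the integrals are well
defined since `u` is semicontinuous", Hörmander, after Thm. 1.6.3); if both parts are infinite the
value is the junk `⊤ - ⊤ = ⊥`. [folklore] -/
def circleMean (g : ℂ → EReal) (c : ℂ) (R : ℝ) : EReal :=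
  (circleUpperMean g c R : EReal) - (circleLowerMean g c R : EReal)

/-- Unfolding of `circleMean`. [folklore] -/
theorem circleMean_def (g : ℂ → EReal) (c : ℂ) (R : ℝ) :
    circleMean g c R = (circleUpperMean g c R : EReal) - (circleLowerMean g c R : EReal) := rfl

/-- The mean value of a constant `x ∈ ℝ` over any circle is `x`. [folklore] -/
theorem circleMean_const (x : ℝ) (c : ℂ) (R : ℝ) :
    circleMean (fun _ ↦ (x : EReal)) c R = x := by
  have hpi : ENNReal.ofReal (2 * Real.pi) ≠ 0 := by
    simp [Real.pi_pos]
  have hpi' : ENNReal.ofReal (2 * Real.pi) ≠ ⊤ := ENNReal.ofReal_ne_top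
  have hvol : volume (Ioc (0 : ℝ) (2 * Real.pi)) = ENNReal.ofReal (2 * Real.pi) := by
    rw [Real.volume_Ioc, sub_zero]
  simp only [circleMean, circleUpperMean, circleLowerMean, lintegral_const, Measure.restrict_apply,
    MeasurableSet.univ, univ_inter, hvol]
  rcases le_total 0 x with hx | hx
  · have h1 : ((x : EReal)).toENNReal = ENNReal.ofReal x := by
      rw [EReal.toENNReal_of_ne_top (EReal.coe_ne_top x), EReal.toReal_coe]
    have h2 : (-(x : EReal)).toENNReal = 0 :=
      EReal.toENNReal_of_nonpos (by exact_mod_cast neg_nonpos.mpr hx)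
    rw [h1, h2, zero_mul, ENNReal.zero_div, ENNReal.mul_div_cancel_right hpi hpi']
    simp [EReal.coe_ennreal_ofReal, max_eq_left hx]
  · have h1 : ((x : EReal)).toENNReal = 0 := EReal.toENNReal_of_nonpos (by exact_mod_cast hx)
    have h2 : (-(x : EReal)).toENNReal = ENNReal.ofReal (-x) := by
      rw [← EReal.coe_neg, EReal.toENNReal_of_ne_top (EReal.coe_ne_top _), EReal.toReal_coe]
    rw [h1, h2, zero_mul, ENNReal.zero_div, ENNReal.mul_div_cancel_right hpi hpi']
    simp [EReal.coe_ennreal_ofReal, max_eq_left (neg_nonneg.mpr hx)]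

/-! ### Subharmonic functions on open subsets of `ℂ` -/

/-- A function `u : ℂ → [-∞, +∞]` is **subharmonic on** the (open) set `U ⊆ ℂ` if it is upper
semicontinuous on `U`, takes values in `[-∞, +∞)` there, and satisfies the mean-value inequality
`u(c) ≤ (2π)⁻¹ ∫₀^{2π} u(c + R e^{iθ}) dθ` for every closed disc `D̄(c, R) ⊆ U`, `R > 0`. This is
Hörmander's Def. 1.6.1 (majorisation by harmonic functions on compacts) in the equivalent form of
Thm. 1.6.3: condition (ii) with the Dirac mass `dμ = δ_R` gives the inequality for every such disc,
and these inequalities are an instance of condition (iii), so for u.s.c. `u` the three are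
equivalent. As in Hörmander the function `≡ -∞` counts as subharmonic. Intended for open `U`
(values of `u` off `U` are irrelevant). [cite: HormanderSCV1973, Def. 1.6.1 and Thm. 1.6.3] -/
def IsSubharmonicOn (u : ℂ → EReal) (U : Set ℂ) : Prop :=
  UpperSemicontinuousOn u U ∧ (∀ z ∈ U, u z < ⊤) ∧
    ∀ ⦃c : ℂ⦄ ⦃R : ℝ⦄, 0 < R → closedBall c R ⊆ U → u c ≤ circleMean u c R

namespace IsSubharmonicOn

variable {u : ℂ → EReal} {U : Set ℂ}

/-- A subharmonic function is upper semicontinuous. [cite: HormanderSCV1973, Def. 1.6.1 (a)] -/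
theorem upperSemicontinuousOn (h : IsSubharmonicOn u U) : UpperSemicontinuousOn u U := h.1

/-- A subharmonic function does not take the value `+∞`. [cite: HormanderSCV1973, Def. 1.6.1] -/
theorem lt_top (h : IsSubharmonicOn u U) {z : ℂ} (hz : z ∈ U) : u z < ⊤ := h.2.1 z hz

/-- The mean-value inequality over circles bounding closed discs in `U`.
[cite: HormanderSCV1973, Thm. 1.6.3 (ii)] -/
theorem le_circleMean (h : IsSubharmonicOn u U) {c : ℂ} {R : ℝ} (hR : 0 < R)
    (hU : closedBall c R ⊆ U) : u c ≤ circleMean u c R := h.2.2 hR hU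

/-- Subharmonicity (in the mean-value form) restricts to smaller sets. [folklore] -/
theorem mono (h : IsSubharmonicOn u U) {V : Set ℂ} (hV : V ⊆ U) : IsSubharmonicOn u V :=
  ⟨h.1.mono hV, fun z hz ↦ h.2.1 z (hV hz), fun _ _ hR hcl ↦ h.2.2 hR (hcl.trans hV)⟩

end IsSubharmonicOn

/-- Real constants are subharmonic on every set. [folklore] -/
theorem isSubharmonicOn_const (x : ℝ) (U : Set ℂ) : IsSubharmonicOn (fun _ ↦ (x : EReal)) U :=
  ⟨upperSemicontinuousOn_const, fun _ _ ↦ EReal.coe_lt_top x,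
    fun c R _ _ ↦ by rw [circleMean_const x c R]⟩

/-- The function `≡ -∞` is subharmonic (Hörmander's convention).
[cite: HormanderSCV1973, Def. 1.6.1 (remark following it)] -/
theorem isSubharmonicOn_bot (U : Set ℂ) : IsSubharmonicOn (fun _ ↦ (⊥ : EReal)) U :=
  ⟨upperSemicontinuousOn_const, fun _ _ ↦ bot_lt_top, fun _ _ _ _ ↦ bot_le⟩

/-! ### Pole sets -/

section PoleSet

variable {E : Type*}

/-- The **pole set** `{u = -∞}` of a function `u : E → [-∞, +∞]`. [folklore] -/
def poleSet (u : E → EReal) : Set E := {z | u z = ⊥}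

/-- Unfolding of `poleSet`. [folklore] -/
@[simp] theorem mem_poleSet_iff (u : E → EReal) (z : E) : z ∈ poleSet u ↔ u z = ⊥ := Iff.rfl

end PoleSet

/-! ### Plurisubharmonic functions -/

section Psh

variable {E : Type*} [NormedAddCommGroup E] [NormedSpace ℂ E]

/-- A function `u : E → [-∞, +∞]` on a complex normed space is **plurisubharmonic on** the (open)
set `Ω ⊆ E` if (a) it is upper semicontinuous on `Ω` with values in `[-∞, +∞)`, and (b) for all
`z, w ∈ E` the function `τ ↦ u(z + τ w)` is subharmonic on the (open) set `{τ ∈ ℂ | z + τ w ∈ Ω}`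
where it is defined. Hörmander's Def. 2.6.1, stated there for `Ω ⊆ ℂⁿ`; the wording is verbatim for
any complex normed space (used with `E = ℂ^{N+1}` = `Fin (N+1) → ℂ`). Equivalent, for u.s.c. `u`,
to the mean-value inequality `u(z) ≤ (2π)⁻¹ ∫₀^{2π} u(z + e^{iθ} w) dθ` whenever
`z + D̄ · w ⊆ Ω`. [cite: HormanderSCV1973, Def. 2.6.1] -/
def IsPlurisubharmonicOn (u : E → EReal) (Ω : Set E) : Prop :=
  UpperSemicontinuousOn u Ω ∧ (∀ z ∈ Ω, u z < ⊤) ∧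
    ∀ z w : E, IsSubharmonicOn (fun τ : ℂ ↦ u (z + τ • w)) {τ | z + τ • w ∈ Ω}

namespace IsPlurisubharmonicOn

variable {u : E → EReal} {Ω : Set E}

/-- A psh function is upper semicontinuous. [cite: HormanderSCV1973, Def. 2.6.1 (a)] -/
theorem upperSemicontinuousOn (h : IsPlurisubharmonicOn u Ω) : UpperSemicontinuousOn u Ω := h.1

/-- A psh function does not take the value `+∞`. [cite: HormanderSCV1973, Def. 2.6.1] -/
theorem lt_top (h : IsPlurisubharmonicOn u Ω) {z : E} (hz : z ∈ Ω) : u z < ⊤ := h.2.1 z hz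

/-- Restrictions of a psh function to complex lines are subharmonic.
[cite: HormanderSCV1973, Def. 2.6.1 (b)] -/
theorem isSubharmonicOn_line (h : IsPlurisubharmonicOn u Ω) (z w : E) :
    IsSubharmonicOn (fun τ : ℂ ↦ u (z + τ • w)) {τ | z + τ • w ∈ Ω} := h.2.2 z w

/-- The mean-value inequality over a circle in a complex line: if `z + τ w ∈ Ω` for `|τ| ≤ R` then
`u(z) ≤ (2π)⁻¹ ∫₀^{2π} u(z + R e^{iθ} w) dθ`. [cite: HormanderSCV1973, Def. 2.6.1 and Thm. 1.6.3 (ii)] -/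
theorem le_circleMean (h : IsPlurisubharmonicOn u Ω) (z w : E) {R : ℝ} (hR : 0 < R)
    (hΩ : ∀ τ : ℂ, ‖τ‖ ≤ R → z + τ • w ∈ Ω) :
    u z ≤ circleMean (fun τ : ℂ ↦ u (z + τ • w)) 0 R := by
  have key := (h.2.2 z w).le_circleMean (c := 0) hR (fun τ hτ ↦ hΩ τ (by simpa using hτ))
  simpa using key

/-- Plurisubharmonicity restricts to smaller sets. [folklore] -/
theorem mono (h : IsPlurisubharmonicOn u Ω) {Ω' : Set E} (hΩ' : Ω' ⊆ Ω) :
    IsPlurisubharmonicOn u Ω' :=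
  ⟨h.1.mono hΩ', fun z hz ↦ h.2.1 z (hΩ' hz),
    fun z w ↦ (h.2.2 z w).mono fun _ hτ ↦ hΩ' hτ⟩

end IsPlurisubharmonicOn

/-- Real constants are plurisubharmonic. [folklore] -/
theorem isPlurisubharmonicOn_const (x : ℝ) (Ω : Set E) :
    IsPlurisubharmonicOn (fun _ : E ↦ (x : EReal)) Ω :=
  ⟨upperSemicontinuousOn_const, fun _ _ ↦ EReal.coe_lt_top x, fun _ _ ↦ isSubharmonicOn_const x _⟩

/-- The function `≡ -∞` is plurisubharmonic (Hörmander's convention).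
[cite: HormanderSCV1973, Def. 2.6.1 and Def. 1.6.1] -/
theorem isPlurisubharmonicOn_bot (Ω : Set E) : IsPlurisubharmonicOn (fun _ : E ↦ (⊥ : EReal)) Ω :=
  ⟨upperSemicontinuousOn_const, fun _ _ ↦ bot_lt_top, fun _ _ ↦ isSubharmonicOn_bot _⟩

/-- A subset `A ⊆ Ω` is **complete pluripolar in `Ω`** if it is exactly the pole set in `Ω` of a
plurisubharmonic function `ψ` on `Ω` that is not identically `-∞` near any point of `Ω`
(i.e. `≢ -∞` on every connected component of the open set `Ω`): `A = {z ∈ Ω | ψ z = -∞}`.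
(BEGZ, Def. 1.2: the "complete pluripolar closed subsets `A`" off which potentials with *small
unbounded locus* are locally bounded; closed analytic subsets `{f₁ = ⋯ = f_k = 0}` are the basic
example, `ψ = log Σ|f_i|`.) Closedness of `A` is NOT part of the predicate. Standard terminology
(used, not defined, in BEGZ Def. 1.2). [folklore] -/
def IsCompletePluripolarIn (A Ω : Set E) : Prop :=
  ∃ ψ : E → EReal, IsPlurisubharmonicOn ψ Ω ∧ (∀ z ∈ Ω, ∃ᶠ y in 𝓝 z, ψ y ≠ ⊥) ∧
    A = Ω ∩ poleSet ψ

end Psh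

/-! ### Lelong numbers -/

section Lelong

variable {E : Type*} [NormedAddCommGroup E]

/-- The **Lelong number** `ν(u, a)` of `u : E → [-∞, +∞]` at `a`:
`ν(u, a) = sup {γ ≥ 0 | ∃ C, u(z) ≤ γ log ‖z - a‖ + C for all z ≠ a near a}`.
For `u` psh near `a` and `≢ -∞` there, the admissible `γ` form the interval `[0, ν(u,a)]`,
`ν(u, a) = lim_{r → 0⁺} (sup_{‖z-a‖ ≤ r} u(z)) / log r = liminf_{z → a} u(z) / log ‖z - a‖`, and the
value does not depend on the choice of (equivalent) norm nor on holomorphic changes of coordinates.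
Junk: `0` if no `γ` is admissible (e.g. `u a' = ⊤` arbitrarily close to `a`) or if every `γ` is
(`u ≡ -∞` near `a`, where classically `ν = +∞`), by the conventions of `Real.sSup`.
[cite: DangDoPham2025, §2.1 (definition of the Lelong number)] -/
def lelongNumber (u : E → EReal) (a : E) : ℝ :=
  sSup {γ : ℝ | 0 ≤ γ ∧ ∃ C : ℝ, ∀ᶠ z in 𝓝[≠] a, u z ≤ ((γ * Real.log ‖z - a‖ + C : ℝ) : EReal)}

/-- The set of admissible slopes in the definition of the Lelong number. [folklore] -/
def lelongSlopes (u : E → EReal) (a : E) : Set ℝ :=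
  {γ : ℝ | 0 ≤ γ ∧ ∃ C : ℝ, ∀ᶠ z in 𝓝[≠] a, u z ≤ ((γ * Real.log ‖z - a‖ + C : ℝ) : EReal)}

/-- Unfolding: `ν(u, a) = sSup (lelongSlopes u a)`. [folklore] -/
theorem lelongNumber_eq_sSup (u : E → EReal) (a : E) :
    lelongNumber u a = sSup (lelongSlopes u a) := rfl

/-- Lelong numbers are non-negative. [cite: DangDoPham2025, §2.1] -/
theorem lelongNumber_nonneg (u : E → EReal) (a : E) : 0 ≤ lelongNumber u a :=
  Real.sSup_nonneg (fun _ hγ ↦ hγ.1)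

/-- `γ = 0` is admissible as soon as `u` is bounded above near `a` (e.g. `u` u.s.c. and `< ⊤` at
`a`). [folklore] -/
theorem zero_mem_lelongSlopes {u : E → EReal} {a : E} {C : ℝ}
    (h : ∀ᶠ z in 𝓝[≠] a, u z ≤ (C : EReal)) : (0 : ℝ) ∈ lelongSlopes u a :=
  ⟨le_rfl, C, h.mono fun z hz ↦ by simpa using hz⟩

/-- If `u ≤ γ log ‖z - a‖ + C` near `a` with `γ ≥ 0`, and the admissible slopes are bounded above
(as they are for `u` psh and `≢ -∞` near `a`), then `γ ≤ ν(u, a)`. [folklore] -/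
theorem le_lelongNumber {u : E → EReal} {a : E} {γ : ℝ} (hγ : γ ∈ lelongSlopes u a)
    (hb : BddAbove (lelongSlopes u a)) : γ ≤ lelongNumber u a :=
  le_csSup hb hγ

/-- The **Lelong upper level set** `E_c(u) = {a ∈ Ω | ν(u, a) ≥ c}` (analytic for `c > 0` and `u`
psh, by Siu's theorem — not vendored here). [folklore] -/
def lelongUpperLevelSet (u : E → EReal) (Ω : Set E) (c : ℝ) : Set E :=
  {a ∈ Ω | c ≤ lelongNumber u a}

/-- Unfolding of `lelongUpperLevelSet`. [folklore] -/
@[simp] theorem mem_lelongUpperLevelSet_iff (u : E → EReal) (Ω : Set E) (c : ℝ) (a : E) :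
    a ∈ lelongUpperLevelSet u Ω c ↔ a ∈ Ω ∧ c ≤ lelongNumber u a := Iff.rfl

end Lelong

end Literature.Analysis.Pluripotential

end
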